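import Literature.MathematicalPhysics.QuantumFieldTheory.Balaban1983to89.B8SockHFPTorusTraceFree
import Literature.MathematicalPhysics.QuantumFieldTheory.Balaban1983to89.B8SockHFPTraceFreePer
import Literature.MathematicalPhysics.QuantumFieldTheory.Balaban1983to89.B8Thm2TorusLettersPerConv

/-!
# `Balaban1983to89.B8SockHFPTorusTraceFreePer` — [Balaban1985RegularSpaces] Thm 4 / Prop 5 (pp. 88–94) for the torus member: the `τ`-free
# ∃λ-bodies of `SockHFP`, `SockHFP₀` for ONE background and a periodic datum, SERVED FROM THE v3 [4] LETTERS `LettersAtPer` (identity laws at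
# PERIODIC arguments only) through the π-converter `B8Thm2TorusLettersPerConv` (sub-row «G-B8-T2S», RULING #4 v3, layer 3(g) of
# `lit-balaban-t2s-1/g2/V3-DESIGN.md`)

statement-level skeleton of published theorems with citation tags; proofs where landed; nothing here is a claim about the
Yang–Mills mass gap

T. Bałaban, *Spaces of regular gauge field configurations on a lattice and gauge fixing conditions*, Commun. Math. Phys. **99** (1985) 75–102
`[Balaban1985RegularSpaces]` ("B8"): Prop. 5 (1.106)–(1.109) p. 94, Thm 4 p. 88, p. 89, p. 77 («Ω_j = T_η»), p. 76, §3 p. 98.  STATUS: published, refereed.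

CITATION HEADER (lean-in-tree rule).  Cell `lit-balaban`, seat `lit-balaban-t2s-1` (gen 2).  WHAT IS PROVED (0 sorry, no `def`).  `gH_per`, `qcq_per_H`,
`HH_per` (the hybrid letters of `B8Thm2TorusLettersPerConv` are periodicity-preserving, from `LettersAtPer`'s (P1)–(P6)); ★ `sockHFPτ_family_of_lettersAtPer`,
★ `sockHFP₀τ_family_of_lettersAtPer` — `B8SockHFPTorusTraceFree.sockHFPτ_family_of_lettersAt ∕ sockHFP₀τ_family_of_lettersAt` VERBATIM except: the
letters are `ℓ : LettersAtPer … k α₀ P U₀` (RULING #4 v3: (E1), (E2), (1.91), (U1), (U2) at periodic arguments only) with `LettersPerTau`, read through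
the hybrid letters `gH ∕ covLapₗ ∕ qH ∕ QTₗ ∕ AwH ∕ cH ∕ HH`; the period is `P = Lᵏ·M`, `U₀` is periodic; the datum `u₁`, `A` is assumed periodic (extra
premises of the ∀-clause); the remainder constant is `B_R + 2` (`hRbd_H`), so the three JOIN windows with `B_R` read at `B_R + 2`; the storey below is
`B8SockHFPTraceFreePer`.  ADDED conclusion: `λ` is `P`-periodic.

HONEST SCOPE.  Verbatim re-threads; [4], [3] Prop. 10, (1.99) NOT proved — the v3 letters are displayed hypotheses (`LettersAtPer`, no supplier in
tree); count-neutral; N05 ∕ `stub_PV3A` NOT discharged; nothing continuum ∕ ℝ⁴ ∕ OS ∕ mass-gap ∕ Clay — the Yang–Mills mass gap is NOT proved.  No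
`sorry`, no `def`, no `… : Prop` fact, no `instance`, no `notation`.
-/

noncomputable section

open NormedSpace
open scoped BigOperators

namespace Literature.MathematicalPhysics.QuantumFieldTheory.Balaban1983to89.B8SockHFPTorusTraceFreePer

open Complex (I)
open MatrixLog (mlog)
open B7Prop1Explicit B7Prop2Explicit B7Prop1Local B7Eq92Concrete
open B7Prop2Explicit (C0 c2')
open B7Prop3Flat (c3)
open B7Prop10General (C6 C4G)
open B7Prop9Flat (C5')
open B7Eq78Linearization (conjR zdBlocking QprimeIter)
open B8Ineq132 (covDerivFwd covDeriv InAk)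
open B8Eq119TwistedAxial (Restr129 InAx bgT)
open B8Eq184Proof (gaugeExp cfgExp)
open B8Eq182Proof (gAd)
open B8Eq188Proof (frakF3)
open B8Lemma1NonAbelian (mulCfg)
open B8Eq140Level (SideTouches)
open B8Ineq130 (tlo thi)
open B8Thm2LogB (blockTop)
open B8Eq138LandauZd (IsLandau138W covDivB covLap QT)
open B8Ineq125Concrete (C2p)
open B8Eq1117Concrete (XSpace)
open B8LeafModelZd3 (SockB9P3)
open B8Prop5ContractionKLevel (Bd2 Mc Kc)
open B8LambdaSpaceKLevel (wt)
open B8Thm4TorusAt (torusLam mem_torusLam_iff)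
open B8Thm2TorusMember (torusLamb mem_torusLamb_iff)
open B8Thm2TorusLetters (torus_member_laws)
open B8Thm2TorusLettersPer (LettersAtPer LettersPerTau)
open B8Thm2TorusLettersPerConv (covLapₗ QTₗ qH gH AwH cH HH gH_apply qH_of_per cH_of_per HH_of_per QTₗ_of_per g_rightΩ_H c_range_H hΔ_H hqs_H hq_H
  hH0_H hH1_H hH2_H hHsupp_H hHequiv_H hQH_H hG_H hGsupp_H hGreal_H hRbd_H hRreal_H hHτ_H hGτ_H hRτ_H)
open B8TorusPeriodization (perz perz_per)
open B8Prop5SocketDatum (sideTouches_pair_of_mem)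
open B8SockHFPTorusTraceFree (apply_eq_zero_of_cfgExp_mem)
open B8SockHFPTraceFreePer (sockHFP_body_of_join_RD_traceFree_per sockHFP₀_body_of_join_RD_traceFree_per)

-- `Site` alone could resolve to the torus sites of `Setup.lean`; re-export the `ℤ^d` sites of `B7Prop1Explicit`.
export B7Prop1Explicit (Site)

variable {d : ℕ} {𝔸 : Type*} [CStarAlgebra 𝔸] [Nontrivial 𝔸]

/-! ## §1 The hybrid letters preserve periodicity -/

section Per

variable {L : ℕ} {BG BR B₀'H B₂' B₀ B₀β cB β : ℝ} {len : Site d → ℝ} {η : ℝ} {m : ℕ} {α₀ : ℝ} {P : ℤ} {U₀ : Site d → Fin d → 𝔸ˣ}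
variable (lt : LettersAtPer (𝔸 := 𝔸) L BG BR B₀'H B₂' B₀ B₀β cB β len η m α₀ P U₀) {n : ℕ}

omit [Nontrivial 𝔸] in
/-- `gH = G′∘π` is periodic-valued ((P1)). [cite: Balaban1985RegularSpaces, (1.95) p.92, §3 p.98] -/
theorem gH_per (hn : 1 ≤ n) (hnm : n ≤ m) : ∀ (f : Site d → 𝔸) (z : Site d) (i : Fin d), gH lt n f (z + P • e i) = gH lt n f z :=
  fun f z i => by rw [gH_apply]; exact lt.gp_per n hn hnm (perz P f) (perz_per P f) z i

omit [Nontrivial 𝔸] in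
/-- `Q′ᵀ·C·Q′` (hybrid) maps periodic functions to periodic functions ((P2), (P5), (P3)). [cite: Balaban1985RegularSpaces, (1.96)–(1.97) p.92, §3 p.98] -/
theorem qcq_per_H (hn : 1 ≤ n) (hnm : n ≤ m) : ∀ f : Site d → 𝔸, (∀ (z : Site d) (i : Fin d), f (z + P • e i) = f z) →
    ∀ (z : Site d) (i : Fin d), QTₗ L n (torusLam (d := d) n) U₀ (cH lt n (qH lt n f)) (z + P • e i) =
      QTₗ L n (torusLam (d := d) n) U₀ (cH lt n (qH lt n f)) z := by
  intro f hf
  have hq := lt.qp_per n hn hnm f hf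
  rw [qH_of_per lt hn hnm hf, cH_of_per lt hq]
  have hc := lt.cinv_per n hn hnm _ hq
  rw [QTₗ_of_per lt hn hnm hc]
  exact lt.qpT_per n hn hnm _ hc

omit [Nontrivial 𝔸] in
/-- `HH = H′∘π_X` maps level-periodic families to periodic functions ((P6)). [cite: Balaban1985RegularSpaces, (1.91)–(1.92) p.91, §3 p.98] -/
theorem HH_per (hn : 1 ≤ n) (hnm : n ≤ m) : ∀ X : XSpace d n 𝔸,
    (∀ (p : Fin (n + 1) × Site d) (i : Fin d), X (p.1, p.2 + (P / (L : ℤ) ^ (p.1 : ℕ)) • e i) = X p) →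
    ∀ (z : Site d) (i : Fin d), HH lt n X (z + P • e i) = HH lt n X z := by
  intro X hX
  rw [HH_of_per lt hX]
  exact lt.hp_per n hn hnm X hX

end Per

/-! ## §2 The `τ`-free, periodic ∃λ-bodies from the v3 letters -/

section Family

variable (τ : 𝔸 →L[ℂ] ℂ)

/-- ★ `B8SockHFPTorusTraceFree.sockHFPτ_family_of_lettersAt` FROM THE v3 LETTERS `LettersAtPer` (periodic datum; `λ` periodic).
[cite: Balaban1985RegularSpaces, Prop. 5 (1.106)–(1.109) p.94, Thm 4 p.88, p.89, p.77, p.76, §3 p.98] -/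
theorem sockHFPτ_family_of_lettersAtPer (hτ : ∀ x y : 𝔸, τ (x * y) = τ (y * x)) (hd2 : 2 ≤ d) {L : ℕ} (hL : 2 ≤ L) {η : ℝ} (hη : 0 < η) {k : ℕ}
    {G H : Subgroup 𝔸ˣ} (hGrp2 : ∀ g ∈ H, ‖(g : 𝔸) - 1‖ ≤ 1 / 8 → τ (mlog (g : 𝔸)) = 0) (hGrp3 : ∀ S : 𝔸, τ S = 0 → expUnit S ∈ H)
    (hGA : AvgClosed d L G) (hGH : G ≤ H) (hGu : G ≤ unitaryUnits 𝔸)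
    {α₀ α₁ B₀ B₀' B₀'H B₂' BG BR B₀β cB9 cB β : ℝ} {len : Site d → ℝ} (hα₀ : 0 < α₀) (hα₁ : 0 < α₁)
    (hB₀ : 0 < B₀) (hB₀' : 0 < B₀') (hB₀'H : 0 < B₀'H) (hB₂' : 0 ≤ B₂') (hBG : 0 ≤ BG) (hBR : 0 ≤ BR)
    {U₀ U' : Site d → Fin d → 𝔸ˣ} (hU₀G : ∀ x κ, U₀ x κ ∈ G) (hU'G : ∀ x κ, U' x κ ∈ G)
    (h33 : InAk L k η α₀ (fun _ => (Set.univ : Set (Site d))) U₀) (h34 : InAk L k η α₀ (fun _ => (Set.univ : Set (Site d))) (mulCfg U' U₀))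
    (hAx : ∀ m', m' ≤ k → InAx L m' (torusLam (d := d) m') U₀ (mulCfg U' U₀))
    (h135 : ∀ j, j ≤ k → ∀ (z : Site d) (μ : Fin d), (∀ x, InBox (loK L j z) (bondHiK L j z μ) x → x ∈ (fun _ => (Set.univ : Set (Site d))) j) →
      ‖(avgIter L (mulCfg U' U₀) j z μ : 𝔸) - (avgIter L U₀ j z μ : 𝔸)‖ ≤ α₁)
    -- the torus: the period `P = Lᵏ·M`, a periodic background, the v3 [4] letters (identity laws at PERIODIC arguments) and their `τ`-add-on
    {P : ℤ} (hPdiv : ∃ M : ℤ, P = (L : ℤ) ^ k * M) (hU₀per : ∀ (z : Site d) (i : Fin d), U₀ (z + P • e i) = U₀ z)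
    (ℓ : LettersAtPer (𝔸 := 𝔸) L BG BR B₀'H B₂' B₀ B₀β cB β len η k α₀ P U₀) (ℓτ : LettersPerTau (𝔸 := 𝔸) τ ℓ)
    (SB9all : ∀ m, m ≤ k → SockB9P3 (𝔸 := 𝔸) L B₀ B₀β cB9 β len η m (fun _ => (Set.univ : Set (Site d)))
      (fun m => torusLam (d := d) m) (fun m => torusLamb (d := d) m))
    (hwin : ∀ cs α₄ cB cDA hE hE₂ lE lE₂ : ℝ, cs = 5 * (d : ℝ) * L * B₀ * (α₀ + α₁) → α₄ = 8 * B₀' * (5 * (d : ℝ) * L * B₀) * (α₀ + α₁) →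
      cB = L * cs → cDA = 2 * (d : ℝ) * (L : ℝ) ^ 2 * cs →
      hE = B₀'H * (C2p d * (40 * d * cB + α₄) * α₄) → hE₂ = B₂' * (C2p d * (40 * d * cB + α₄) * α₄) →
      lE = B₀'H * (4 * C2p d * (40 * d * cB + 2 * α₄)) → lE₂ = B₂' * (4 * C2p d * (40 * d * cB + 2 * α₄)) →
      36 * d * B₀ * cs ≤ 1 / 2 ∧
      8 * (131072 * ((d : ℝ) + 1) ^ 2) * Real.exp (4 * (800 * ((d : ℝ) + 1) ^ 2 * ((d : ℝ) + 4)) * α₀) ≤ 16 * (131072 * ((d : ℝ) + 1) ^ 2) ∧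
      2 * cs ^ 2 + 20 * d * α₀ * cs + 2 * (16 * (131072 * ((d : ℝ) + 1) ^ 2)) * cs ^ 2 ≤ α₀ + α₁ ∧
      (d : ℝ) * L * α₁ ≤ 1 / 8 ∧
      α₀ ≤ cB9 ∧ cs ≤ cB9 ∧
      C0 d * α₀ ≤ 1 / 3 ∧ 4 * α₀ ≤ c2' d L ∧
      Real.exp (4 * (800 * ((d : ℝ) + 1) ^ 2 * ((d : ℝ) + 4)) * α₀) * (1 + 8 * (131072 * ((d : ℝ) + 1) ^ 2) * cB) ≤ 2 ∧
      2 * cB ≤ c3 d L ∧ 2048 * (d : ℝ) * cB ≤ 1 ∧ 40 * d * cB ≤ 1 / 200 ∧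
      200 * C6 d * (2 * α₄) ≤ 1 ∧ 12000 * ((d : ℝ) + 1) * L * (2 * α₄) ≤ 1 ∧
      C4G d L * (α₀ + 40 * d * cB + 4 * (2 * α₄)) ≤ 1 ∧
      1024 * ((d : ℝ) + 1) * ((d : ℝ) + 4) * L ^ 2 * α₀ ≤ 1 ∧ 32 * ((d : ℝ) + 1) ^ 2 * C6 d * L ^ 2 * α₀ ≤ 1 ∧
      16 * d * C5' d * C6 d * (L : ℝ) ^ 2 * α₀ ≤ 1 ∧ 8 * d * C6 d * L * α₀ ≤ 1 ∧
      40 * d * cB + α₄ ≤ 1 / (4 * B₀'H * (2 * C2p d)) ∧ 2 * C6 d * (40 * d * cB + 4 * α₄) ≤ 1 / 8 ∧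
      cB ≤ 1 / 13 ∧ α₄ / 4 + hE ≤ 1 / 24 ∧ α₄ / 4 + hE ≤ 1 / 140 ∧ 10 * (α₄ / 4 + hE) * (BR + 2) ≤ 1 / 2 ∧
      BG * Mc d (BR + 2) (α₄ / 4 + hE) cB hE₂ cDA ≤ α₄ / 4 ∧
      BG * Kc d (BR + 2) (α₄ / 4 + hE) cB hE₂ cDA lE₂ (1 + lE) (1 + lE) ≤ 1 / 2) :
    ∀ m, 1 ≤ m → m < k → ∀ (u₁ : Site d → 𝔸ˣ) (U₁ : Site d → Fin d → 𝔸ˣ) (A : Site d → Fin d → 𝔸),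
      (∀ x, u₁ x ∈ G) → (∀ (z : Site d) (i : Fin d), u₁ (z + P • e i) = u₁ z) → (∀ (z : Site d) (i : Fin d), A (z + P • e i) = A z) →
      mgauge U₀ u₁ U₁ = U' → Restr129 L m (torusLam (d := d) m) U₀ u₁ →
      IsLandau138W L m η (Set.univ : Set (Site d)) (torusLam (d := d) m) U₀ U₁ →
      (∀ j, j ≤ m → ∀ b ∈ {b : Site d × Fin d | SideTouches ((fun _ => (Set.univ : Set (Site d))) j) b.1 b.2},
        U₁ b.1 b.2 = cfgExp η A b.1 b.2 ∧ IsSelfAdjoint (A b.1 b.2) ∧ ‖A b.1 b.2‖ ≤ (5 * (d : ℝ) * L * B₀ * (α₀ + α₁)) * ((L : ℝ) ^ j * η)⁻¹) →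
      ∃ lam : Site d → 𝔸, (∀ (z : Site d) (i : Fin d), lam (z + P • e i) = lam z) ∧
        (∀ x, IsSelfAdjoint (lam x)) ∧ (∀ x, x ∉ (fun _ => (Set.univ : Set (Site d))) 0 → lam x = 0) ∧ (∀ x, τ (lam x) = 0) ∧
        (∀ j, j ≤ m + 1 → ∀ b ∈ {b : Site d × Fin d | SideTouches ((fun _ => (Set.univ : Set (Site d))) j) b.1 b.2},
          ‖lam b.1‖ ≤ 8 * B₀' * (5 * (d : ℝ) * L * B₀) * (α₀ + α₁) ∧
            ((L : ℝ) ^ j * η) * ‖covDerivFwd η U₀ b.2 lam b.1‖ ≤ 8 * B₀' * (5 * (d : ℝ) * L * B₀) * (α₀ + α₁)) ∧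
        (∃ μ : ℕ → Site d → 𝔸, ∀ x ∈ (fun _ => (Set.univ : Set (Site d))) 0,
          covLap η U₀ (((fun _ => (Set.univ : Set (Site d))) 0).indicator fun y => covDivB η U₀ A y + covLap η U₀ lam y +
            ((conjR (gaugeExp lam y)⁻¹ (covDivB η U₀ A y) - covDivB η U₀ A y) +
              (gAd (covLap η U₀ lam y) (lam y) - covLap η U₀ lam y) + ∑ μ, frakF3 η U₀ lam A y μ)) x =
            QT L (m + 1) ((fun m => torusLam (d := d) m) (m + 1)) U₀ μ x) ∧
        Restr129 L (m + 1) ((fun m => torusLam (d := d) m) (m + 1)) U₀ (u₁ * gaugeExp lam) := by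
  intro m hm1 hmk u₁ U₁ A hu₁G hu₁per hAper hW h129 hLan hdat
  have hL1 : 1 ≤ L := le_trans (by norm_num) hL
  have hLr : (1 : ℝ) ≤ L := by exact_mod_cast hL1
  obtain ⟨hΩ, -, htw, h8lt, h8top⟩ := torus_member_laws (d := d) hL k
  -- the windows at this (α₀, α₁)
  obtain ⟨hside, hC₂, h61, hsmall₁, hα₀9, hcs9, hα3, hα4, hsmall, hc₃, hsc, hα₃', hs₁, hs₂, hs₃, hs₄, hs₅, hs₆, hs₇, hsm, hprod8, hcA', ha₁',
    hb₁', hθ, h103, h106⟩ := hwin _ _ _ _ _ _ _ _ rfl rfl rfl rfl rfl rfl rfl rfl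
  have hmK : m + 1 ≤ k := hmk
  have hcs0 : 0 ≤ 5 * (d : ℝ) * L * B₀ * (α₀ + α₁) := by
    have : 0 ≤ α₀ + α₁ := by linarith
    positivity
  have hcDAlo : (d : ℝ) * (L : ℝ) ^ 2 * (5 * (d : ℝ) * L * B₀ * (α₀ + α₁)) ≤ 2 * (d : ℝ) * (L : ℝ) ^ 2 * (5 * (d : ℝ) * L * B₀ * (α₀ + α₁)) := by
    have h := mul_nonneg (by positivity : (0 : ℝ) ≤ (d : ℝ) * (L : ℝ) ^ 2) hcs0
    linarith only [h]
  -- unitary/`H`-valued data from `G`-valuedness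
  have hU' : ∀ x κ, U' x κ ∈ unitaryUnits 𝔸 := fun x κ => hGu (hU'G x κ)
  have hu₁ : ∀ x, u₁ x ∈ unitaryUnits 𝔸 := fun x => hGu (hu₁G x)
  have hu₁H : ∀ x, u₁ x ∈ H := fun x => hGH (hu₁G x)
  -- member geometry at the torus: every constraint bond is interior, `Ω_j = T_η`
  have hbox : ∀ m, m ≤ k → ∀ j, j ≤ m → ∀ c ∈ (fun m => torusLamb (d := d) m) m j, ∀ x : Site d,
      InBox (loK L j c.1) (bondHiK L j c.1 c.2) x → x ∈ (fun _ => (Set.univ : Set (Site d))) j := fun _ _ _ _ _ _ _ _ => Set.mem_univ _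
  have hclass : ∀ m, m ≤ k → ∀ j, j ≤ m → ∀ c ∈ (fun m => torusLamb (d := d) m) m j,
      (c.1 ∈ (fun m => torusLam (d := d) m) m j ∧ c.1 + e c.2 ∈ (fun m => torusLam (d := d) m) m j) ∨
      (∃ j', j = j' + 1 ∧ (∀ x, (L : ℤ) • c.1 ≤ x → x ≤ (L : ℤ) • c.1 + blockTop L → x ∈ (fun m => torusLam (d := d) m) m j') ∧
        c.1 + e c.2 ∈ (fun m => torusLam (d := d) m) m j) ∨
      (∃ j', j = j' + 1 ∧ c.1 ∈ (fun m => torusLam (d := d) m) m j ∧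
        (∀ x, (L : ℤ) • (c.1 + e c.2) ≤ x → x ≤ (L : ℤ) • (c.1 + e c.2) + blockTop L → x ∈ (fun m => torusLam (d := d) m) m j')) := by
    intro m _ j _ c hc
    have hj : j = m := (mem_torusLamb_iff m j c).1 hc
    exact Or.inl ⟨(mem_torusLam_iff m j c.1).2 hj, (mem_torusLam_iff m j _).2 hj⟩
  -- the datum's exponent is `τ`-free on every bond: `e^{iηA} = U₁ = u₁⁻¹U′u₁(·+e)` is `G`-valued within `⅛` of `1`
  have hU₁G : ∀ x κ, U₁ x κ ∈ G := by
    intro x κ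
    have h := congrFun (congrFun hW x) κ
    rw [mgauge_apply] at h
    have hU₁ : U₁ x κ = (u₁ x)⁻¹ * U' x κ * Rc (U₀ x κ) (u₁ (x + e κ)) := by
      rw [← h]; group
    rw [hU₁, Rc_apply]
    exact G.mul_mem (G.mul_mem (G.inv_mem (hu₁G x)) (hU'G x κ))
      (G.mul_mem (G.mul_mem (hU₀G x κ) (hu₁G _)) (G.inv_mem (hU₀G x κ)))
  have h16 : 16 * (5 * (d : ℝ) * L * B₀ * (α₀ + α₁)) ≤ 1 := by
    have hd0 : (1 : ℝ) ≤ d := by exact_mod_cast (show 1 ≤ d by omega)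
    have hcsB : 5 * (d : ℝ) * L * B₀ * (α₀ + α₁) ≤ L * (5 * (d : ℝ) * L * B₀ * (α₀ + α₁)) := le_mul_of_one_le_left hcs0 hLr
    have hcBsmall : (d : ℝ) * (L * (5 * (d : ℝ) * L * B₀ * (α₀ + α₁))) ≤ 1 / 8000 := by linarith only [hα₃']
    have h1 : 5 * (d : ℝ) * L * B₀ * (α₀ + α₁) ≤ 1 / 8000 :=
      ((le_mul_of_one_le_left hcs0 hd0).trans (mul_le_mul_of_nonneg_left hcsB (by positivity))).trans hcBsmall
    linarith only [h1]
  have hAτ : ∀ j, j ≤ m → ∀ b ∈ {b : Site d × Fin d | SideTouches ((fun _ => (Set.univ : Set (Site d))) j) b.1 b.2}, τ (A b.1 b.2) = 0 := by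
    intro j hj b hb
    obtain ⟨hexp, -, hbd⟩ := hdat j hj b hb
    have hmem : cfgExp η A b.1 b.2 ∈ G := by rw [← hexp]; exact hU₁G b.1 b.2
    refine apply_eq_zero_of_cfgExp_mem τ hGH hGrp2 hη hmem ?_
    have hLj : (1 : ℝ) ≤ (L : ℝ) ^ j := one_le_pow₀ hLr
    calc η * ‖A b.1 b.2‖ ≤ η * ((5 * (d : ℝ) * L * B₀ * (α₀ + α₁)) * ((L : ℝ) ^ j * η)⁻¹) := mul_le_mul_of_nonneg_left hbd hη.le
      _ = (5 * (d : ℝ) * L * B₀ * (α₀ + α₁)) * ((L : ℝ) ^ j)⁻¹ := by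
          field_simp
      _ ≤ (5 * (d : ℝ) * L * B₀ * (α₀ + α₁)) * 1 := mul_le_mul_of_nonneg_left (inv_le_one_of_one_le₀ hLj) hcs0
      _ ≤ 1 / 16 := by linarith only [h16]
  -- the letters at the truncation `m + 1` and their `τ`-laws
  have hn1 : 1 ≤ m + 1 := by omega
  -- the torus data of the per-storey: every `Lʲ ∣ P`, the constraint sets and the side-touching are shift-invariant
  have hdivP : ∀ j, j ≤ m + 1 → ((L : ℤ) ^ j ∣ P) := fun j hj => by
    obtain ⟨M, hM⟩ := hPdiv
    exact ⟨(L : ℤ) ^ (k - j) * M, by rw [hM, ← mul_assoc, ← pow_add, Nat.add_sub_cancel' (hj.trans hmK)]⟩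
  have hΛP : ∀ j, j ≤ m + 1 → ∀ (y : Site d) (i : Fin d),
      y + (P / (L : ℤ) ^ j) • e i ∈ (fun m => torusLam (d := d) m) (m + 1) j ↔ y ∈ (fun m => torusLam (d := d) m) (m + 1) j :=
    fun j _ y i => by simp only [mem_torusLam_iff]
  have hΩP : ∀ j, j ≤ m → ∀ (x : Site d) (κ : Fin d) (i : Fin d),
      SideTouches ((fun _ => (Set.univ : Set (Site d))) j) (x + P • e i) κ ↔ SideTouches ((fun _ => (Set.univ : Set (Site d))) j) x κ :=
    fun j _ x κ i => ⟨fun _ => (sideTouches_pair_of_mem hd2 (Set.mem_univ x) κ).1, fun _ => (sideTouches_pair_of_mem hd2 (Set.mem_univ _) κ).1⟩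
  exact sockHFP_body_of_join_RD_traceFree_per τ hτ hd2 hL hη P hGrp2 hGrp3 hGA hGH hGu hΩ hbox hclass hm1 hmk (htw (m + 1) hmK) (h8lt m hmk)
    (h8top m hmk) hα₀ hα₁ hB₀ hB₀' rfl rfl hU₀G hU' h33 h34 hAx h135 hu₁ hu₁H hW h129 hLan hdat hAτ (SB9all m hmk.le) hα₀9 hcs9 hside hC₂ h61
    hsmall₁
    (gH ℓ (m + 1)) (covLapₗ η U₀) (qH ℓ (m + 1)) (QTₗ L (m + 1) (torusLam (d := d) (m + 1)) U₀) (AwH ℓ (m + 1)) (cH ℓ (m + 1))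
    (g_rightΩ_H ℓ hn1 hmK) (c_range_H ℓ hn1 hmK) hdivP hΛP hΩP hU₀per hAper hu₁per (gH_per ℓ hn1 hmK) (qcq_per_H ℓ hn1 hmK)
    hΔ_H hqs_H (hq_H ℓ) (HH ℓ (m + 1)) hB₀'H hB₂' hBG (by linarith : (0 : ℝ) ≤ BR + 2) (hH0_H ℓ hn1 hmK hB₀'H.le)
    (hH1_H ℓ hn1 hmK hB₀'H.le) (hH2_H ℓ hn1 hmK hB₂') (hHsupp_H ℓ) (hHequiv_H ℓ hn1 hmK) (HH_per ℓ hn1 hmK) (hQH_H ℓ hn1 hmK)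
    (hG_H ℓ hn1 hmK) (hGsupp_H ℓ) (hGreal_H ℓ hn1 hmK) (hRbd_H ℓ hn1 hmK) (hRreal_H ℓ hn1 hmK) (hHτ_H ℓ τ hn1 hmK ℓτ)
    (hGτ_H ℓ τ hn1 hmK ℓτ) (hRτ_H ℓ τ hn1 hmK ℓτ)
    le_rfl le_rfl hcDAlo hα3 hα4 hsmall hc₃ hsc hα₃' hs₁ hs₂ hs₃ hs₄ hs₅ hs₆ hs₇ hsm hprod8 rfl rfl rfl rfl hcA' ha₁' hb₁' hθ h103 h106


/-- ★ `B8SockHFPTorusTraceFree.sockHFP₀τ_family_of_lettersAt` FROM THE v3 LETTERS `LettersAtPer` (base datum `u₁ = 1`, periodic `A`; `λ` periodic).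
[cite: Balaban1985RegularSpaces, Prop. 5 (1.106)–(1.109) p.94, p.89 (the start of the induction), p.77, p.76, §3 p.98] -/
theorem sockHFP₀τ_family_of_lettersAtPer (hτ : ∀ x y : 𝔸, τ (x * y) = τ (y * x)) (hd2 : 2 ≤ d) {L : ℕ} (hL : 2 ≤ L) {η : ℝ} (hη : 0 < η) {k : ℕ}
    (hk : 1 ≤ k)
    {G H : Subgroup 𝔸ˣ} (hGrp2 : ∀ g ∈ H, ‖(g : 𝔸) - 1‖ ≤ 1 / 8 → τ (mlog (g : 𝔸)) = 0) (hGrp3 : ∀ S : 𝔸, τ S = 0 → expUnit S ∈ H)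
    (hGA : AvgClosed d L G) (hGH : G ≤ H) (hGu : G ≤ unitaryUnits 𝔸)
    {α₀ α₁ B₀ B₀' B₀'H B₂' BG BR B₀β cB9 cB β : ℝ} {len : Site d → ℝ} (hα₀ : 0 < α₀) (hα₁ : 0 < α₁)
    (hB₀ : 0 < B₀) (hB₀' : 0 < B₀') (hB₀'H : 0 < B₀'H) (hB₂' : 0 ≤ B₂') (hBG : 0 ≤ BG) (hBR : 0 ≤ BR)
    {U₀ U' : Site d → Fin d → 𝔸ˣ} (hU₀G : ∀ x κ, U₀ x κ ∈ G) (hU'G : ∀ x κ, U' x κ ∈ G)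
    (h33 : InAk L k η α₀ (fun _ => (Set.univ : Set (Site d))) U₀) (h34 : InAk L k η α₀ (fun _ => (Set.univ : Set (Site d))) (mulCfg U' U₀))
    (hAx : ∀ m', m' ≤ k → InAx L m' (torusLam (d := d) m') U₀ (mulCfg U' U₀))
    -- the torus: the period `P = Lᵏ·M`, a periodic background, the v3 [4] letters (identity laws at PERIODIC arguments) and their `τ`-add-on
    {P : ℤ} (hPdiv : ∃ M : ℤ, P = (L : ℤ) ^ k * M) (hU₀per : ∀ (z : Site d) (i : Fin d), U₀ (z + P • e i) = U₀ z)
    (ℓ : LettersAtPer (𝔸 := 𝔸) L BG BR B₀'H B₂' B₀ B₀β cB β len η k α₀ P U₀) (ℓτ : LettersPerTau (𝔸 := 𝔸) τ ℓ)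
    (hwin : ∀ cs α₄ cB cDA hE hE₂ lE lE₂ : ℝ, cs = 5 * (d : ℝ) * L * B₀ * (α₀ + α₁) → α₄ = 8 * B₀' * (5 * (d : ℝ) * L * B₀) * (α₀ + α₁) →
      cB = L * cs → cDA = 2 * (d : ℝ) * (L : ℝ) ^ 2 * cs →
      hE = B₀'H * (C2p d * (40 * d * cB + α₄) * α₄) → hE₂ = B₂' * (C2p d * (40 * d * cB + α₄) * α₄) →
      lE = B₀'H * (4 * C2p d * (40 * d * cB + 2 * α₄)) → lE₂ = B₂' * (4 * C2p d * (40 * d * cB + 2 * α₄)) →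
      36 * d * B₀ * cs ≤ 1 / 2 ∧
      8 * (131072 * ((d : ℝ) + 1) ^ 2) * Real.exp (4 * (800 * ((d : ℝ) + 1) ^ 2 * ((d : ℝ) + 4)) * α₀) ≤ 16 * (131072 * ((d : ℝ) + 1) ^ 2) ∧
      2 * cs ^ 2 + 20 * d * α₀ * cs + 2 * (16 * (131072 * ((d : ℝ) + 1) ^ 2)) * cs ^ 2 ≤ α₀ + α₁ ∧
      (d : ℝ) * L * α₁ ≤ 1 / 8 ∧
      α₀ ≤ cB9 ∧ cs ≤ cB9 ∧
      C0 d * α₀ ≤ 1 / 3 ∧ 4 * α₀ ≤ c2' d L ∧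
      Real.exp (4 * (800 * ((d : ℝ) + 1) ^ 2 * ((d : ℝ) + 4)) * α₀) * (1 + 8 * (131072 * ((d : ℝ) + 1) ^ 2) * cB) ≤ 2 ∧
      2 * cB ≤ c3 d L ∧ 2048 * (d : ℝ) * cB ≤ 1 ∧ 40 * d * cB ≤ 1 / 200 ∧
      200 * C6 d * (2 * α₄) ≤ 1 ∧ 12000 * ((d : ℝ) + 1) * L * (2 * α₄) ≤ 1 ∧
      C4G d L * (α₀ + 40 * d * cB + 4 * (2 * α₄)) ≤ 1 ∧
      1024 * ((d : ℝ) + 1) * ((d : ℝ) + 4) * L ^ 2 * α₀ ≤ 1 ∧ 32 * ((d : ℝ) + 1) ^ 2 * C6 d * L ^ 2 * α₀ ≤ 1 ∧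
      16 * d * C5' d * C6 d * (L : ℝ) ^ 2 * α₀ ≤ 1 ∧ 8 * d * C6 d * L * α₀ ≤ 1 ∧
      40 * d * cB + α₄ ≤ 1 / (4 * B₀'H * (2 * C2p d)) ∧ 2 * C6 d * (40 * d * cB + 4 * α₄) ≤ 1 / 8 ∧
      cB ≤ 1 / 13 ∧ α₄ / 4 + hE ≤ 1 / 24 ∧ α₄ / 4 + hE ≤ 1 / 140 ∧ 10 * (α₄ / 4 + hE) * (BR + 2) ≤ 1 / 2 ∧
      BG * Mc d (BR + 2) (α₄ / 4 + hE) cB hE₂ cDA ≤ α₄ / 4 ∧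
      BG * Kc d (BR + 2) (α₄ / 4 + hE) cB hE₂ cDA lE₂ (1 + lE) (1 + lE) ≤ 1 / 2) :
    ∀ (A : Site d → Fin d → 𝔸), (∀ (z : Site d) (i : Fin d), A (z + P • e i) = A z) →
      (∀ j, j ≤ 0 → ∀ b ∈ {b : Site d × Fin d | SideTouches ((fun _ => (Set.univ : Set (Site d))) j) b.1 b.2},
        U' b.1 b.2 = cfgExp η A b.1 b.2 ∧ IsSelfAdjoint (A b.1 b.2) ∧ ‖A b.1 b.2‖ ≤ (5 * (d : ℝ) * L * B₀ * (α₀ + α₁)) * ((L : ℝ) ^ j * η)⁻¹) →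
      ∃ lam : Site d → 𝔸, (∀ (z : Site d) (i : Fin d), lam (z + P • e i) = lam z) ∧
        (∀ x, IsSelfAdjoint (lam x)) ∧ (∀ x, x ∉ (fun _ => (Set.univ : Set (Site d))) 0 → lam x = 0) ∧ (∀ x, τ (lam x) = 0) ∧
        (∀ j, j ≤ 1 → ∀ b ∈ {b : Site d × Fin d | SideTouches ((fun _ => (Set.univ : Set (Site d))) j) b.1 b.2},
          ‖lam b.1‖ ≤ 8 * B₀' * (5 * (d : ℝ) * L * B₀) * (α₀ + α₁) ∧
            ((L : ℝ) ^ j * η) * ‖covDerivFwd η U₀ b.2 lam b.1‖ ≤ 8 * B₀' * (5 * (d : ℝ) * L * B₀) * (α₀ + α₁)) ∧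
        (∃ μ : ℕ → Site d → 𝔸, ∀ x ∈ (fun _ => (Set.univ : Set (Site d))) 0,
          covLap η U₀ (((fun _ => (Set.univ : Set (Site d))) 0).indicator fun y => covDivB η U₀ A y + covLap η U₀ lam y +
            ((conjR (gaugeExp lam y)⁻¹ (covDivB η U₀ A y) - covDivB η U₀ A y) +
              (gAd (covLap η U₀ lam y) (lam y) - covLap η U₀ lam y) + ∑ μ, frakF3 η U₀ lam A y μ)) x =
            QT L 1 ((fun m => torusLam (d := d) m) 1) U₀ μ x) ∧
        Restr129 L 1 ((fun m => torusLam (d := d) m) 1) U₀ ((1 : Site d → 𝔸ˣ) * gaugeExp lam) := by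
  intro A hAper hdat
  have hL1 : 1 ≤ L := le_trans (by norm_num) hL
  have hLr : (1 : ℝ) ≤ L := by exact_mod_cast hL1
  obtain ⟨hΩ, -, htw, -, -⟩ := torus_member_laws (d := d) hL k
  -- the windows at this (α₀, α₁)
  obtain ⟨hside, hC₂, h61, hsmall₁, hα₀9, hcs9, hα3, hα4, hsmall, hc₃, hsc, hα₃', hs₁, hs₂, hs₃, hs₄, hs₅, hs₆, hs₇, hsm, hprod8, hcA', ha₁',
    hb₁', hθ, h103, h106⟩ := hwin _ _ _ _ _ _ _ _ rfl rfl rfl rfl rfl rfl rfl rfl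
  have hcs0 : 0 ≤ 5 * (d : ℝ) * L * B₀ * (α₀ + α₁) := by
    have : 0 ≤ α₀ + α₁ := by linarith
    positivity
  -- the datum's exponent is `τ`-free on every bond: `e^{iηA} = U′` is `G`-valued within `⅛` of `1`
  have h16 : 16 * (5 * (d : ℝ) * L * B₀ * (α₀ + α₁)) ≤ 1 := by
    have hd0 : (1 : ℝ) ≤ d := by exact_mod_cast (show 1 ≤ d by omega)
    have hcsB : 5 * (d : ℝ) * L * B₀ * (α₀ + α₁) ≤ L * (5 * (d : ℝ) * L * B₀ * (α₀ + α₁)) := le_mul_of_one_le_left hcs0 hLr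
    have hcBsmall : (d : ℝ) * (L * (5 * (d : ℝ) * L * B₀ * (α₀ + α₁))) ≤ 1 / 8000 := by linarith only [hα₃']
    have h1 : 5 * (d : ℝ) * L * B₀ * (α₀ + α₁) ≤ 1 / 8000 :=
      ((le_mul_of_one_le_left hcs0 hd0).trans (mul_le_mul_of_nonneg_left hcsB (by positivity))).trans hcBsmall
    linarith only [h1]
  have hAτ : ∀ j, j ≤ 0 → ∀ b ∈ {b : Site d × Fin d | SideTouches ((fun _ => (Set.univ : Set (Site d))) j) b.1 b.2}, τ (A b.1 b.2) = 0 := by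
    intro j hj b hb
    obtain ⟨hexp, -, hbd⟩ := hdat j hj b hb
    have hmem : cfgExp η A b.1 b.2 ∈ G := by rw [← hexp]; exact hU'G b.1 b.2
    refine apply_eq_zero_of_cfgExp_mem τ hGH hGrp2 hη hmem ?_
    have hLj : (1 : ℝ) ≤ (L : ℝ) ^ j := one_le_pow₀ hLr
    calc η * ‖A b.1 b.2‖ ≤ η * ((5 * (d : ℝ) * L * B₀ * (α₀ + α₁)) * ((L : ℝ) ^ j * η)⁻¹) := mul_le_mul_of_nonneg_left hbd hη.le
      _ = (5 * (d : ℝ) * L * B₀ * (α₀ + α₁)) * ((L : ℝ) ^ j)⁻¹ := by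
          field_simp
      _ ≤ (5 * (d : ℝ) * L * B₀ * (α₀ + α₁)) * 1 := mul_le_mul_of_nonneg_left (inv_le_one_of_one_le₀ hLj) hcs0
      _ ≤ 1 / 16 := by linarith only [h16]
  have hk1 : 1 ≤ k := hk
  -- the torus data of the per-storey: every `Lʲ ∣ P`, the constraint sets and the side-touching are shift-invariant
  have hdivP : ∀ j, j ≤ 1 → ((L : ℤ) ^ j ∣ P) := fun j hj => by
    obtain ⟨M, hM⟩ := hPdiv
    exact ⟨(L : ℤ) ^ (k - j) * M, by rw [hM, ← mul_assoc, ← pow_add, Nat.add_sub_cancel' (hj.trans hk1)]⟩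
  have hΛP : ∀ j, j ≤ 1 → ∀ (y : Site d) (i : Fin d),
      y + (P / (L : ℤ) ^ j) • e i ∈ (fun m => torusLam (d := d) m) (1) j ↔ y ∈ (fun m => torusLam (d := d) m) (1) j :=
    fun j _ y i => by simp only [mem_torusLam_iff]
  have hΩP : ∀ j, j ≤ 0 → ∀ (x : Site d) (κ : Fin d) (i : Fin d),
      SideTouches ((fun _ => (Set.univ : Set (Site d))) j) (x + P • e i) κ ↔ SideTouches ((fun _ => (Set.univ : Set (Site d))) j) x κ :=
    fun j _ x κ i => ⟨fun _ => (sideTouches_pair_of_mem hd2 (Set.mem_univ x) κ).1, fun _ => (sideTouches_pair_of_mem hd2 (Set.mem_univ _) κ).1⟩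
  exact sockHFP₀_body_of_join_RD_traceFree_per τ hτ hd2 hL hη P hk hGrp2 hGrp3 hGA hGH hGu hΩ (htw 1 hk1) hα₀ hα₁ hB₀ hB₀' rfl rfl hU₀G h33 h34
    hAx hdat hAτ
    (gH ℓ (1)) (covLapₗ η U₀) (qH ℓ (1)) (QTₗ L (1) (torusLam (d := d) (1)) U₀) (AwH ℓ (1)) (cH ℓ (1))
    (g_rightΩ_H ℓ le_rfl hk1) (c_range_H ℓ le_rfl hk1) hdivP hΛP hΩP hU₀per hAper (gH_per ℓ le_rfl hk1) (qcq_per_H ℓ le_rfl hk1)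
    hΔ_H hqs_H (hq_H ℓ) (HH ℓ (1)) hB₀'H hB₂' hBG (by linarith : (0 : ℝ) ≤ BR + 2) (hH0_H ℓ le_rfl hk1 hB₀'H.le)
    (hH1_H ℓ le_rfl hk1 hB₀'H.le) (hH2_H ℓ le_rfl hk1 hB₂') (hHsupp_H ℓ) (hHequiv_H ℓ le_rfl hk1) (HH_per ℓ le_rfl hk1) (hQH_H ℓ le_rfl hk1)
    (hG_H ℓ le_rfl hk1) (hGsupp_H ℓ) (hGreal_H ℓ le_rfl hk1) (hRbd_H ℓ le_rfl hk1) (hRreal_H ℓ le_rfl hk1) (hHτ_H ℓ τ le_rfl hk1 ℓτ)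
    (hGτ_H ℓ τ le_rfl hk1 ℓτ) (hRτ_H ℓ τ le_rfl hk1 ℓτ)
    le_rfl le_rfl le_rfl hα3 hα4 hsmall hc₃ hsc hα₃' hs₁ hs₂ hs₃ hs₄ hs₅ hs₆ hs₇ hsm hprod8 rfl rfl rfl rfl hcA' ha₁' hb₁' hθ h103 h106

end Family

#print axioms sockHFPτ_family_of_lettersAtPer
#print axioms sockHFP₀τ_family_of_lettersAtPer

end Literature.MathematicalPhysics.QuantumFieldTheory.Balaban1983to89.B8SockHFPTorusTraceFreePer

end
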